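import Summits.CriticalPhenomena.Ising3DConformalLimit.Theses.PrecisionLaplacian
import Summits.CriticalPhenomena.Ising3DConformalLimit.Theorems.HyperoctahedralRPHRP2Rigidity
import HarnessLib

/-!
# `PrecisionLaplacian.StableConeRPRigidity` (stmt-CriticalPhenomena-4800) — PROVED

**Theorem (`StableConeRPRigidity_proof`).**  The crux `L_iso` of route `PrecisionLaplacian`: let `1 ≤ α < 2`,
`Φ` an admissible angular profile and `K > 0` continuous on `ℝ³ ∖ 0`, homogeneous of degree `α - 3`, the potential
kernel of the symmetric `α`-stable generator with angular Lévy density `Φ`; if `K` is invariant and reflection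
positive (finite sums over points of the open half-space) for each of the nine lattice mirrors `eᵢ`, `eᵢ ± eⱼ`, then
`K` is invariant under every linear isometry of `ℝ³`.

**Proof.**  The line `entire-profile-null-growth` (lead: this seat; skeleton
`Cruxes/StableConeRPRigidity/Lines/entire-profile-null-growth.lean`) reduces the crux to NINE-MIRROR RP RIGIDITY FOR
EVERY DEGREE `0 < β < 4` (`C⁺`), discarding `(Φ, potential equation)` and setting `β := 3 - α ∈ (1, 2]`.  `C⁺` is the
composition of the seven registered stubs S1–S7 of the line (S1 Bernstein–Widder half-plane continuation per mirror,
S2 strip tiling, S3 periodic Liouville, S4 planar four-line rigidity, S5 RP of the probed axial X-ray, S6 X-ray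
reduction, S7 Mellin axial symmetry); all seven are landed — S3–S6 by this line's workers
(`Theorems/PrecisionLaplacianStableConeRPRigidity{PeriodicTypeLiouville,PlanarRigidityLemma,ProbedXRayRP,XRayReduction}.lean`),
S1, S2, S7 by the sibling line `xray-mellin-transfer` of crux `HRP2Rigidity` (stmt-CriticalPhenomena-1979), which
adopted this line's stub texts verbatim — and composed into
`Summit.CriticalPhenomena.Ising3DConformalLimit.Cruxes.HRP2Rigidity.XRayMellin.nineMirrorRigidityBelowFour`
(`Theorems/HyperoctahedralRPHRP2Rigidity.lean`).  This file applies that theorem with `β = 3 - α`.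
-/

namespace Summit.CriticalPhenomena.Ising3DConformalLimit.Cruxes.StableConeRPRigidity.EntireProfileNullGrowth

open Summit.CriticalPhenomena.Ising3DConformalLimit.Theses

/-- **The crux `PrecisionLaplacian.StableConeRPRigidity` (stmt-CriticalPhenomena-4800), proved**: unbundle the
crux's binders, discard `(Φ, potential equation)`, set `β := 3 - α ∈ (1,2] ⊂ (0,4)` and apply nine-mirror RP rigidity
below degree four (`HRP2Rigidity.XRayMellin.nineMirrorRigidityBelowFour`, the composition of the seven landed stubs of
the line `entire-profile-null-growth`).  The RP conjunct of the crux is `IsMirrorRPKernel n K` definitionally. -/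
theorem StableConeRPRigidity_proof :
    _root_.Summit.CriticalPhenomena.Ising3DConformalLimit.Theses.PrecisionLaplacian.StableConeRPRigidity := by
  intro α Φ K h1 h2 _hc _hnn _hpos _hev hKc hKp hhom _hpot hmir
  have hhom' : ∀ c : ℝ, 0 < c → ∀ x, K (c • x) = c ^ (-(3 - α)) * K x := by
    intro c hc' x
    rw [show (-(3 - α) : ℝ) = α - 3 by ring]
    exact hhom c hc' x
  exact _root_.Summit.CriticalPhenomena.Ising3DConformalLimit.Cruxes.HRP2Rigidity.XRayMellin.nineMirrorRigidityBelowFour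
    (3 - α) K (by linarith) (by linarith) hKc hKp hhom' hmir

end Summit.CriticalPhenomena.Ising3DConformalLimit.Cruxes.StableConeRPRigidity.EntireProfileNullGrowth
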